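import Summits.BirchSwinnertonDyer.Rank1Residual.Ordinary.LocalPointsModPrimePower
import HarnessLib

/-!
# The identification `E(ℚ_p)/p^n·E(ℚ_p) ≅ ℤ/p^n` sending a point with `m_p(P) = 0` to `1` EXISTS (the
# rank-one freeness of the local condition at `p` on C-16's letter; theorems only — no definition, no named
# fact, nothing asserted about any curve's BSD; C-16 stays a CONJECTURE)

HONEST FRAMING (cell `b2b-bsdres`, run/shared/lean/b2b/bsd-rank1-residual/, verbatim in every
file): the goal of the cell is to DELETE the COMBINATION-SHAPED residual classes of the
Birch–Swinnerton-Dyer formula for ALL analytic-rank `≤ 1` elliptic curves over `ℚ` — "full BSD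
formula for every rank `≤ 1` curve in class `C`" assembled STRICTLY from published theorems — so
that the rank-`≤ 1` remainder becomes exactly the CONSTRUCTION-SHAPED classes, which are TYPED
(missing-input `Prop`s), NOT attempted. This is not "finishing BSD". Seat `b2b-bsdres-additive-p3`
(X8 prover B / X7 joint; typer-designate for the cell conjecture C-16 = hyp C120.1 by hyp R-16 (e)).
This file books nothing and moves no mark; X7 / X8 stay CONSTRUCTION-SHAPED.

## What this file does

The reciprocity skeleton of `R1-DEPTH-LAW.md` §2 (`Ordinary/DepthLawReciprocitySkeleton.lean`) and its
local-exponent companions (`Ordinary/LocalClassOrders.lean`, `Ordinary/Conjectures/KuriharaExactOrderFromReciprocity.lean`)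
quantify over identifications `φ : E(ℚ_p) ↠ ℤ/p^n` with kernel `p^n·E(ℚ_p)` — the statement "`H¹_f(ℚ_p, E[p^n]) =
E(ℚ_p)/p^n` is free of rank one over `ℤ/p^n`". The sibling `Ordinary/LocalPointsModPrimePower.lean` proved the
substance (`generates_mod_pow_of_not_exists_p_smul_eq`: every `R ∈ E(ℚ_p)` is `c·P + p^k·Q`, and
`c·P ∈ p^k·E(ℚ_p) ⇒ p^k ∣ c`, for a point `P ∉ p·E(ℚ_p)` at a good non-anomalous odd `p`). This file turns that
into the EXISTENCE of the identification, normalised by `φ(P) = 1`: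
* §1 (abstract) `exists_addMonoidHom_zmod_of_generates`: in any additive commutative group, a decomposition
  `R = c(R)·x + q·Q(R)` with the uniqueness clause `c·x ∈ q·G ⇒ q ∣ c` yields `φ : G →+ ℤ/q`, surjective, with
  kernel exactly `q·G` and `φ x = 1` (well-definedness of `R ↦ c(R) mod q` is the uniqueness clause);
* §2 `exists_addMonoidHom_zmod_pow_of_not_exists_p_smul_eq` (odd good non-anomalous `p`, `P ∉ p·E(ℚ_p)`) and
  **`exists_addMonoidHom_zmod_pow_three_of_not_pointLocallyThreeDivisibleAt`** (C-16's letter: `3` good,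
  `a₃ ∉ {1, −2}`, `¬ O5.PointLocallyThreeDivisibleAt W 3 P`): for every `n` there is `φ : E(ℚ₃) →+ ℤ/3^n`,
  surjective, kernel `3^n·E(ℚ₃)`, with `φ(P) = 1` — so the skeleton's `φ₃` hypothesis is never vacuous on the
  letter, and the class of `P` is the chosen generator (`ord₃ φ(P) = 0`).

References: J. H. Silverman, AEC 2nd ed. (2009), IV.6.4 (b), VII.2.1 (through the sibling) [SilvermanAEC2009];
`R1-DEPTH-LAW.md` §2 (i), (iii); hyp `SHARPENED-CONJECTURES.md` §120.
-/

noncomputable section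

open scoped Classical

open WeierstrassCurve Literature.NumberTheory.EllipticCurves

namespace Summit.BirchSwinnertonDyer.Rank1Residual.Ordinary

/-! ### §1 Abstract: a generator with the uniqueness clause gives the identification `G/q·G ≅ ℤ/q` -/

section Abstract

variable {G : Type*} [AddCommGroup G]

/-- **From «every `R` is `c·x + q·Q`, and `c·x ∈ q·G ⇒ q ∣ c`» to an identification `φ : G ↠ ℤ/q` with kernel
`q·G` and `φ x = 1`.** (`R ↦ c(R) mod q` is well defined and additive by the uniqueness clause.) [folklore] -/
theorem exists_addMonoidHom_zmod_of_generates {q : ℕ} [NeZero q] (x : G)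
    (hgen : ∀ R : G, ∃ (c : ℤ) (Q : G), R = c • x + q • Q)
    (huniq : ∀ (c : ℤ) (Q : G), c • x = q • Q → (q : ℤ) ∣ c) :
    ∃ φ : G →+ ZMod q,
      Function.Surjective φ ∧ (∀ g : G, φ g = 0 ↔ ∃ h : G, q • h = g) ∧ φ x = 1 := by
  choose c Q hcQ using hgen
  -- well-definedness: any decomposition of `R` has the same coefficient modulo `q`
  have hwd : ∀ (R : G) (c' : ℤ) (Q' : G), R = c' • x + q • Q' → ((c R : ℤ) : ZMod q) = c' := by
    intro R c' Q' hR
    have h : c R • x + q • Q R = c' • x + q • Q' := (hcQ R).symm.trans hR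
    have h1 : (c R - c') • x = q • (Q' - Q R) := by
      rw [sub_smul, smul_sub, sub_eq_sub_iff_add_eq_add, h, add_comm]
    have h2 := huniq _ _ h1
    rw [ZMod.intCast_eq_intCast_iff_dvd_sub]
    rwa [dvd_sub_comm]
  have hx1 : ((c x : ℤ) : ZMod q) = 1 := by
    have h := hwd x 1 0 (by rw [one_smul, smul_zero, add_zero])
    rwa [Int.cast_one] at h
  refine ⟨AddMonoidHom.mk' (fun R => ((c R : ℤ) : ZMod q)) ?_, ?_, ?_, hx1⟩
  · intro R S
    show ((c (R + S) : ℤ) : ZMod q) = ((c R : ℤ) : ZMod q) + ((c S : ℤ) : ZMod q)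
    rw [← Int.cast_add]
    refine hwd (R + S) (c R + c S) (Q R + Q S) ?_
    calc R + S = (c R • x + q • Q R) + (c S • x + q • Q S) := by rw [← hcQ R, ← hcQ S]
      _ = (c R + c S) • x + q • (Q R + Q S) := by rw [add_smul, smul_add]; abel
  · intro z
    refine ⟨(z.val : ℤ) • x, ?_⟩
    show ((c ((z.val : ℤ) • x) : ℤ) : ZMod q) = z
    rw [hwd ((z.val : ℤ) • x) (z.val : ℤ) 0 (by rw [smul_zero, add_zero]), Int.cast_natCast,
      ZMod.natCast_zmod_val]
  · intro g
    show ((c g : ℤ) : ZMod q) = 0 ↔ ∃ h : G, q • h = g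
    constructor
    · intro h0
      obtain ⟨d, hd⟩ := (ZMod.intCast_zmod_eq_zero_iff_dvd (c g) q).mp h0
      refine ⟨d • x + Q g, ?_⟩
      have h1 : c g • x = q • (d • x) := by rw [hd, mul_smul, natCast_zsmul]
      rw [smul_add, ← h1]
      exact (hcQ g).symm
    · rintro ⟨h, rfl⟩
      have h0 := hwd (q • h) 0 h (by rw [zero_smul, zero_add])
      rwa [Int.cast_zero] at h0

end Abstract

/-! ### §2 `E(ℚ_p)/p^n ≅ ℤ/p^n` with a chosen `m_p = 0` point ↦ `1`; C-16's letter at `p = 3` -/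

section Padic

variable (W : WeierstrassCurve ℚ) [W.IsElliptic] [W.IsGloballyMinimal] (p : ℕ) [Fact p.Prime]

/-- **The identification `E(ℚ_p)/p^n·E(ℚ_p) ≅ ℤ/p^n` with `P ↦ 1` EXISTS** at an odd prime `p ∤ Δ_min(E)` with
`p ∤ #Ẽ(𝔽_p)`, for any `P ∉ p·E(ℚ_p)` and every `n`: a surjective additive `φ : E(ℚ_p) → ℤ/p^n` with kernel
exactly `p^n·E(ℚ_p)` and `φ P = 1` (sibling `generates_mod_pow_of_not_exists_p_smul_eq` + §1) — the rank-one
freeness of `H¹_f(ℚ_p, E[p^n])`, generated by the class of `P`. [cite: SilvermanAEC2009, IV.6.4 (b) and VII.2.1] -/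
theorem exists_addMonoidHom_zmod_pow_of_not_exists_p_smul_eq (hp2 : p ≠ 2)
    (hgood : ¬ (p : ℤ) ∣ minimalDiscriminantInt W) (hna : ¬ p ∣ W.reductionPointCount p)
    {P : (W.baseChange ℚ_[p]).toAffine.Point} (hP : ¬ ∃ Q : (W.baseChange ℚ_[p]).toAffine.Point, p • Q = P)
    (n : ℕ) :
    ∃ φ : (W.baseChange ℚ_[p]).toAffine.Point →+ ZMod (p ^ n),
      Function.Surjective φ ∧ (∀ g, φ g = 0 ↔ ∃ h, p ^ n • h = g) ∧ φ P = 1 := by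
  haveI : NeZero (p ^ n) := ⟨pow_ne_zero n (Fact.out : p.Prime).ne_zero⟩
  obtain ⟨hgen, huniq⟩ := generates_mod_pow_of_not_exists_p_smul_eq W p hp2 hgood hna hP n
  refine exists_addMonoidHom_zmod_of_generates P hgen (fun c Q h => ?_)
  rw [Nat.cast_pow]
  exact huniq c Q h

/-- **On C-16's letter at `3`** (`3` good, `a₃ ∉ {1, −2}`, `m₃(P) = 0` as `¬ O5.PointLocallyThreeDivisibleAt W 3 P`):
for every `n` there is a surjective additive `φ : E(ℚ₃) → ℤ/3^n` with kernel `3^n·E(ℚ₃)` and `φ(P) = 1` — the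
skeleton's `φ₃` EXISTS and the class of `P` is the chosen generator. [cite: SilvermanAEC2009, IV.6.4 (b) and VII.2.1] -/
theorem exists_addMonoidHom_zmod_pow_three_of_not_pointLocallyThreeDivisibleAt
    (hgood : W.HasGoodReductionAtPrime 3) (ha1 : W.frobeniusTrace 3 ≠ 1) (ha2 : W.frobeniusTrace 3 ≠ -2)
    {P : W.toAffine.Point} (hP : ¬ O5.PointLocallyThreeDivisibleAt W 3 P) (n : ℕ) :
    ∃ φ : (W.baseChange ℚ_[3]).toAffine.Point →+ ZMod (3 ^ n),
      Function.Surjective φ ∧ (∀ g, φ g = 0 ↔ ∃ h, 3 ^ n • h = g) ∧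
        φ (Affine.Point.map (W' := W.toAffine) (Algebra.ofId ℚ ℚ_[3]) P) = 1 := by
  haveI : NeZero (3 ^ n) := ⟨pow_ne_zero n (by norm_num)⟩
  obtain ⟨hgen, huniq⟩ := generates_mod_pow_three_of_not_pointLocallyThreeDivisibleAt W hgood ha1 ha2 hP n
  refine exists_addMonoidHom_zmod_of_generates _ hgen (fun c Q h => ?_)
  exact_mod_cast huniq c Q h

end Padic

end Summit.BirchSwinnertonDyer.Rank1Residual.Ordinary

end
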